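import Mathlib
import Summits.Ventures.PercRepro.TriangleCapFourBelowResidueA

/-!
# PercRepro — TOOLS FOR THE ONE-TRIANGLE RESIDUE AT `r = 4` ON THE CELLS `m = 4k − 20` (p3, gen 39; part 132)

The general deficit bound `sum_sq_le_of_deficit` (`Σ a_y² + |Y| t² ≤ d² + 2t Σ a_y` for `a_y ≤ t` with
`Σ a_y + d = |Y| t` — i.e. the private-set count `Σ a_y (t − a_y)` is at least `d (t − d)`), from
`Σ b_y² ≤ (Σ b_y)²`; and the structural fact `not_adj_of_degIn_compl_eq_zero`: when `w` has no neighbour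
outside the triangle, the vertices outside that are neither private to `u` nor outer are all adjacent to `v`,
hence pairwise non-adjacent (a second triangle otherwise).  Axioms: standard.
-/

namespace PercRepro

namespace TriangleCap

namespace C047

open Finset

variable {V : Type*} [Fintype V] [DecidableEq V]

omit [Fintype V] [DecidableEq V] in
/-- `Σ b_y² ≤ (Σ b_y)²` in `ℕ`. -/
theorem sum_sq_le_sq_sum_nat (Y : Finset V) (b : V → ℕ) :
    ∑ y ∈ Y, b y * b y ≤ (∑ y ∈ Y, b y) * (∑ y ∈ Y, b y) := by
  rw [sum_mul_sum]
  apply sum_le_sum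
  intro i hi
  exact single_le_sum (f := fun j => b i * b j) (fun j _ => Nat.zero_le _) hi

omit [Fintype V] [DecidableEq V] in
/-- **THE DEFICIT BOUND.** `a_y ≤ t` on `Y` with `Σ a_y + d = |Y| t`: `Σ a_y² + |Y| t² ≤ d² + 2 t Σ a_y` —
i.e. `Σ a_y (t − a_y) ≥ d (t − d)`. -/
theorem sum_sq_le_of_deficit (Y : Finset V) (a : V → ℕ) (t d : ℕ) (ha : ∀ y ∈ Y, a y ≤ t)
    (hd : ∑ y ∈ Y, a y + d = Y.card * t) :
    ∑ y ∈ Y, a y * a y + Y.card * (t * t) ≤ d * d + 2 * t * ∑ y ∈ Y, a y := by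
  obtain ⟨b, hb⟩ : ∃ b : V → ℕ, ∀ y ∈ Y, a y + b y = t :=
    ⟨fun y => t - a y, fun y hy => Nat.add_sub_cancel' (ha y hy)⟩
  have hsum : ∑ y ∈ Y, b y = d := by
    have h1 : ∑ y ∈ Y, (a y + b y) = Y.card * t := by
      rw [sum_congr rfl hb, sum_const, smul_eq_mul]
    rw [sum_add_distrib] at h1
    omega
  have h1 : ∑ y ∈ Y, t * b y = ∑ y ∈ Y, (a y * b y + b y * b y) := by
    apply sum_congr rfl
    intro y hy
    rw [← hb y hy]
    ring
  have h2 : ∑ y ∈ Y, t * a y = ∑ y ∈ Y, (a y * a y + a y * b y) := by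
    apply sum_congr rfl
    intro y hy
    rw [← hb y hy]
    ring
  rw [← mul_sum, hsum, sum_add_distrib] at h1
  rw [← mul_sum, sum_add_distrib] at h2
  have h3 := sum_sq_le_sq_sum_nat Y b
  rw [hsum] at h3
  have h4 : Y.card * (t * t) = t * ∑ y ∈ Y, a y + t * d := by
    rw [← mul_assoc, ← hd]
    ring
  linarith [h1, h2, h3, h4]

omit [Fintype V] in
/-- The three orderings of a triangle give the same Finset. -/
theorem triple_comm_mid (u v w : V) : ({u, w, v} : Finset V) = {u, v, w} := by
  ext x; simp only [mem_insert, mem_singleton]; tauto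

/-- **NO EDGE AMONG THE NON-PRIVATE, NON-OUTER VERTICES WHEN `w` HAS NO NEIGHBOUR OUTSIDE:** such a vertex is
adjacent to `v` (not to `u`: not private; not to `w`; to some triangle vertex: not outer), and two adjacent
ones would form a second triangle with `v`. -/
theorem not_adj_of_degIn_compl_eq_zero (D : SimpleGraph V) [DecidableRel D.Adj] {u v w : V}
    (hT : ∀ a b c, D.Adj a b → D.Adj a c → D.Adj b c → a = u ∨ a = v ∨ a = w)
    (hw : degIn D ({u, v, w} : Finset V)ᶜ w = 0) {y y' : V}
    (hy : y ∈ (({u, v, w} : Finset V)ᶜ \ (({u, v, w} : Finset V)ᶜ).filter (fun x => D.Adj u x)) \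
      (({u, v, w} : Finset V)ᶜ).filter (fun z => degIn D {u, v, w} z = 0))
    (hy' : y' ∈ (({u, v, w} : Finset V)ᶜ \ (({u, v, w} : Finset V)ᶜ).filter (fun x => D.Adj u x)) \
      (({u, v, w} : Finset V)ᶜ).filter (fun z => degIn D {u, v, w} z = 0)) :
    ¬ D.Adj y y' := by
  have key : ∀ z, z ∈ (({u, v, w} : Finset V)ᶜ \ (({u, v, w} : Finset V)ᶜ).filter (fun x => D.Adj u x)) \
      (({u, v, w} : Finset V)ᶜ).filter (fun z => degIn D {u, v, w} z = 0) →
      z ∈ ({u, v, w} : Finset V)ᶜ ∧ D.Adj v z := by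
    intro z hz
    rw [mem_sdiff, mem_sdiff, mem_filter, mem_filter] at hz
    obtain ⟨⟨hzS, hzP⟩, hzQ⟩ := hz
    refine ⟨hzS, ?_⟩
    have hnu : ¬ D.Adj u z := fun h => hzP ⟨hzS, h⟩
    have hnw : ¬ D.Adj w z := by
      intro h
      have : 1 ≤ degIn D ({u, v, w} : Finset V)ᶜ w := by
        unfold degIn
        apply card_pos.mpr
        exact ⟨z, mem_filter.mpr ⟨hzS, h⟩⟩
      omega
    have hpos : 0 < degIn D {u, v, w} z := Nat.pos_of_ne_zero (fun h => hzQ ⟨hzS, h⟩)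
    unfold degIn at hpos
    obtain ⟨s, hs⟩ := card_pos.mp hpos
    rw [mem_filter, mem_insert, mem_insert, mem_singleton] at hs
    rcases hs.1 with h | h | h
    · subst h; exact absurd hs.2.symm hnu
    · subst h; exact hs.2.symm
    · subst h; exact absurd hs.2.symm hnw
  intro hadj
  obtain ⟨hyS, hyv⟩ := key y hy
  obtain ⟨_, hy'v⟩ := key y' hy'
  rw [mem_compl] at hyS
  rcases hT y y' v hadj hyv.symm hy'v.symm with h | h | h
  · subst h; exact hyS (mem_insert_self _ _)
  · subst h; exact hyS (mem_insert_of_mem (mem_insert_self _ _))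
  · subst h; exact hyS (mem_insert_of_mem (mem_insert_of_mem (mem_singleton_self _)))

end C047

end TriangleCap

end PercRepro
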